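import Summits.AtomisticToContinuum.Crystallization.Theorems.MinimisingLawsHaveAtoms.Negative.DilatedLawEnergy
import Summits.AtomisticToContinuum.Crystallization.Theorems.MinimisingLawsHaveAtoms.Negative.DilatedLawDiffuse
import Summits.AtomisticToContinuum.Crystallization.Theorems.MinimisingLawsHaveAtoms.Negative.OnePointNull

/-!
# Negative knowledge for crux `MinimisingLawsHaveAtoms` (stmt-AtomisticToContinuum-15776), XIII:
# THRESHOLD SHARPNESS — for every `e > e*` the crux with `≤ e` is false; no coercivity of purity

Standing crux disprover `cdisprove-stmt-AtomisticToContinuum-15776`,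
`--supports stmt-AtomisticToContinuum-15776`; assembly of Parts VI–XII.

Take the abstract minimising law `P₀` of the frame (`OnePointMixtures.exists_minimising_law`:
probability, a.s. `δ₀`-hard-core, point-stationary, `E[h] = e*`), pull it back to the configuration
space (`DilatedLawMecke.map_comap_toMeasure`), and dilate it by a factor `c` UNIFORM on
`[1, 1 + η]`.  The dilated law is a probability law (`isProbabilityMeasure_dilatedLaw`), a.s.
`δ₀`-hard-core (`ae_isRootedHardCore_dilatedLaw`), point-stationary
(`isPointStationaryLaw_dilatedLaw` + `IsPointStationaryLaw.map_mapSmul`), of mean root energy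
`≤ e* + 125 δ₀⁻⁶ · η/2` (`integral_rootEnergy_dilatedLaw_le`), and charges NO rooted isometry class
(`dilatedLaw_rootedClass_eq_zero`; the one-point configuration is `P₀`-null by
`OnePointNull.measure_setOf_eq_dirac_zero_eq_zero`).  Hence:

* `exists_diffuse_law_lt` — for every `e > e*` there is a law in the frame of the crux
  (probability, a.s. hard-core, point-stationary) with `E[h] ≤ e` charging no rooted class;
* `not_minimisingLawsHaveAtoms_at_relaxed_threshold` — **the crux with `∫ rootEnergy ≤ e` in place
  of `≤ e*` is FALSE for every `e > e*`**: any proof must use the exact value `e*`, no argument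
  stable under perturbation of the energy level can work;
* `not_coercive_purity` — **refutation of the natural quantitative strengthening** (S⁺4 of the
  crux's STRATEGY-CENSUS): there is NO `κ > 0` with `E_P[h] − e* ≥ κ · (1 − sup_Y P(rootedClass Y))`
  over the frame — isometry-diffuse point-stationary hard-core laws have energies accumulating at
  `e*`; purity, if true, is not coercive.
All `[folklore]`.
-/

noncomputable section

namespace Summit.AtomisticToContinuum.Crystallization.Theorems.MinimisingLawsHaveAtoms.Negative.ThresholdSharpness

open MeasureTheory Set Filter Metric Function
open scoped ENNReal Topology
open Literature.MathematicalPhysics.StatisticalMechanics Literature.Probability.Process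
open Literature.Probability.Process.LocalConfig
open Summit.AtomisticToContinuum.Crystallization.Theorems.ChargedEnergyGapNegative (eStar eStar_le)
open Summit.AtomisticToContinuum.Crystallization.Theorems.BenjaminiSchrammLimit
  (measurableEmbedding_toMeasure)
open Summit.AtomisticToContinuum.Crystallization.Theorems.MinimisingLawsCohesive.Negative.OnePointMixtures
  (exists_minimising_law)
open Summit.AtomisticToContinuum.Crystallization.Theorems.MinimisingLawsHaveAtoms.Negative.DilationFamily
open Summit.AtomisticToContinuum.Crystallization.Theorems.MinimisingLawsHaveAtoms.Negative.DilatedLawMecke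
open Summit.AtomisticToContinuum.Crystallization.Theorems.MinimisingLawsHaveAtoms.Negative.DilatedLawEnergy
open Summit.AtomisticToContinuum.Crystallization.Theorems.MinimisingLawsHaveAtoms.Negative.DilatedLawDiffuse
open Summit.AtomisticToContinuum.Crystallization.Theorems.MinimisingLawsHaveAtoms.Negative.OnePointNull

/-! ## §1 The uniform dilation law on `[1, 1 + η]` -/

/-- The normalised Lebesgue measure on `[1, 1+η]` is a probability measure … [folklore] -/
theorem isProbabilityMeasure_unifDil {η : ℝ} (hη : 0 < η) :
    IsProbabilityMeasure ((ENNReal.ofReal η)⁻¹ • (volume : Measure ℝ).restrict (Icc 1 (1 + η))) := by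
  refine ⟨?_⟩
  rw [Measure.smul_apply, Measure.restrict_apply_univ, Real.volume_Icc, smul_eq_mul,
    show (1 : ℝ) + η - 1 = η by ring, ENNReal.inv_mul_cancel (ENNReal.ofReal_pos.2 hη).ne'
      ENNReal.ofReal_ne_top]

/-- … with no atoms … [folklore] -/
theorem nullSingletonClass_unifDil (η : ℝ) :
    NullSingletonClass ((ENNReal.ofReal η)⁻¹ • (volume : Measure ℝ).restrict (Icc 1 (1 + η))) :=
  ⟨fun x => by rw [Measure.smul_apply, measure_singleton, smul_zero]⟩

/-- … giving mass `0` to `(−∞, 1]` … [folklore] -/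
theorem unifDil_Iic {η : ℝ} :
    ((ENNReal.ofReal η)⁻¹ • (volume : Measure ℝ).restrict (Icc 1 (1 + η))) (Iic 1) = 0 := by
  rw [Measure.smul_apply, Measure.restrict_apply measurableSet_Iic, smul_eq_mul]
  refine mul_eq_zero_of_right _ ?_
  refine measure_mono_null (fun x hx => ?_) (measure_singleton (1 : ℝ))
  exact le_antisymm hx.1 hx.2.1

/-- … concentrated on `[1, 2]` for `η ≤ 1` … [folklore] -/
theorem ae_unifDil_mem {η : ℝ} (hη1 : η ≤ 1) :
    ∀ᵐ c ∂((ENNReal.ofReal η)⁻¹ • (volume : Measure ℝ).restrict (Icc 1 (1 + η))), 1 ≤ c ∧ c ≤ 2 := by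
  refine Measure.ae_smul_measure ?_ _
  filter_upwards [ae_restrict_mem measurableSet_Icc] with c hc
  exact ⟨hc.1, hc.2.trans (by linarith)⟩

/-- … and with `E[c − 1] ≤ η`. [folklore] -/
theorem integral_unifDil_sub_one_le {η : ℝ} (hη : 0 < η) :
    (∫ c, (c - 1) ∂((ENNReal.ofReal η)⁻¹ • (volume : Measure ℝ).restrict (Icc 1 (1 + η)))) ≤ η := by
  haveI := isProbabilityMeasure_unifDil hη
  have hle : (fun c : ℝ => c - 1) ≤ᵐ[(ENNReal.ofReal η)⁻¹ • (volume : Measure ℝ).restrict (Icc 1 (1 + η))]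
      fun _ => η := by
    refine Measure.ae_smul_measure ?_ _
    filter_upwards [ae_restrict_mem measurableSet_Icc] with c hc
    linarith [hc.2]
  have hint : Integrable (fun c : ℝ => c - 1)
      ((ENNReal.ofReal η)⁻¹ • (volume : Measure ℝ).restrict (Icc 1 (1 + η))) :=
    (integrable_const (η + 1)).mono' (measurable_id.sub_const 1).aestronglyMeasurable
      (Measure.ae_smul_measure (by
        filter_upwards [ae_restrict_mem measurableSet_Icc] with c hc
        rw [Real.norm_eq_abs, abs_le]; constructor <;> linarith [hc.1, hc.2]) _)
  calc (∫ c, (c - 1) ∂((ENNReal.ofReal η)⁻¹ • (volume : Measure ℝ).restrict (Icc 1 (1 + η))))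
      ≤ ∫ _c, η ∂((ENNReal.ofReal η)⁻¹ • (volume : Measure ℝ).restrict (Icc 1 (1 + η))) :=
        integral_mono_ae hint (integrable_const _) hle
    _ = η := by rw [integral_const, probReal_univ, one_smul]

/-! ## §2 Diffuse laws of the frame at every energy level above `e*` -/

/-- **For every `e > e*` there is an isometry-DIFFUSE law in the frame of the crux with
`E[h] ≤ e`** (the abstract minimising law, randomly dilated). [folklore] -/
theorem exists_diffuse_law_lt {e : ℝ} (he : eStar < e) :
    ∃ δ : ℝ, 0 < δ ∧ ∃ P : Measure (Measure (EuclideanSpace ℝ (Fin 3))),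
      IsProbabilityMeasure P ∧ (∀ᵐ μ ∂P, IsRootedHardCore δ μ) ∧ IsPointStationaryLaw P ∧
      (∫ μ, rootEnergy lennardJones μ ∂P) ≤ e ∧
      ∀ Y : Set (EuclideanSpace ℝ (Fin 3)), P {μ | ∃ A : EuclideanSpace ℝ (Fin 3) →ₗᵢ[ℝ]
        EuclideanSpace ℝ (Fin 3), ∃ q ∈ Y, μ = (Measure.count : Measure
          (EuclideanSpace ℝ (Fin 3))).restrict ((fun s => A (s - q)) '' Y)} = 0 := by
  obtain ⟨δ, hδ, P₀, hP₀, hhc, hst, hE⟩ := exists_minimising_law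
  haveI : Fact (0 < δ) := ⟨hδ⟩
  haveI := hP₀
  have hEmb := measurableEmbedding_toMeasure (EuclideanSpace ℝ (Fin 3)) (δ := δ)
  -- pull back to the configuration space
  set Q : Measure (RootedHardCoreConfig (EuclideanSpace ℝ (Fin 3)) δ) :=
    P₀.comap fun S : RootedHardCoreConfig (EuclideanSpace ℝ (Fin 3)) δ =>
      (S.1 : LocalConfig (EuclideanSpace ℝ (Fin 3))).toMeasure with hQdef
  haveI hQ : IsProbabilityMeasure Q := isProbabilityMeasure_comap_toMeasure hhc
  have hQmap : Q.map (fun S : RootedHardCoreConfig (EuclideanSpace ℝ (Fin 3)) δ =>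
      (S.1 : LocalConfig (EuclideanSpace ℝ (Fin 3))).toMeasure) = P₀ := map_comap_toMeasure hhc
  -- the dilation law
  set η : ℝ := min 1 ((e - eStar) / (125 * δ⁻¹ ^ 6)) with hηdef
  have hη : 0 < η := lt_min one_pos (div_pos (by linarith) (by positivity))
  have hη1 : η ≤ 1 := min_le_left _ _
  set ν : Measure ℝ := (ENNReal.ofReal η)⁻¹ • (volume : Measure ℝ).restrict (Icc 1 (1 + η)) with hνdef
  haveI hν : IsProbabilityMeasure ν := isProbabilityMeasure_unifDil hη
  haveI hνa : NullSingletonClass ν := nullSingletonClass_unifDil η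
  refine ⟨δ, hδ, ((ν.prod Q).map fun p : ℝ × RootedHardCoreConfig (EuclideanSpace ℝ (Fin 3)) δ =>
      (⟨LocalConfig.mk ((fun x : EuclideanSpace ℝ (Fin 3) => max p.1 1 • x) ''
          ((p.2.1 : LocalConfig (EuclideanSpace ℝ (Fin 3))) : Set (EuclideanSpace ℝ (Fin 3)))),
        smul_image_rooted_separated (le_max_right _ _) p.2.2.1 p.2.2.2⟩ :
          RootedHardCoreConfig (EuclideanSpace ℝ (Fin 3)) δ)).map
      fun S : RootedHardCoreConfig (EuclideanSpace ℝ (Fin 3)) δ =>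
        (S.1 : LocalConfig (EuclideanSpace ℝ (Fin 3))).toMeasure,
    isProbabilityMeasure_dilatedLaw Q ν, ae_isRootedHardCore_dilatedLaw Q ν,
    isPointStationaryLaw_dilatedLaw Q ν (hQmap ▸ hst), ?_, fun Y => ?_⟩
  · -- energy: `≤ E_Q[h] + 125 δ⁻⁶ E[c-1] ≤ e* + (e - e*)`
    have h1 := integral_rootEnergy_dilatedLaw_le Q ν (ae_unifDil_mem hη1)
    have h2 : (∫ S, rootEnergy lennardJones ((S.1 : LocalConfig (EuclideanSpace ℝ (Fin 3))).toMeasure) ∂Q) =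
        eStar := by
      rw [← hE, ← hQmap, hEmb.integral_map]
    have h3 := integral_unifDil_sub_one_le hη
    have h4 : 125 * δ⁻¹ ^ 6 * η ≤ e - eStar := by
      have := min_le_right 1 ((e - eStar) / (125 * δ⁻¹ ^ 6))
      rw [← hηdef, le_div_iff₀ (by positivity)] at this
      linarith
    have h5 : 125 * δ⁻¹ ^ 6 * (∫ c, (c - 1) ∂ν) ≤ 125 * δ⁻¹ ^ 6 * η :=
      mul_le_mul_of_nonneg_left h3 (by positivity)
    linarith
  · -- no rooted class is charged
    refine dilatedLaw_rootedClass_eq_zero Q ν unifDil_Iic ?_ Y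
    -- the one-point configuration is `P₀`-null (Part VII), transported by `comap`
    have h0 := measure_setOf_eq_dirac_zero_eq_zero hδ hhc hst hE.le
    rw [hQdef, hEmb.comap_apply]
    refine measure_mono_null ?_ h0
    rintro _ ⟨S, hS, rfl⟩
    rw [mem_setOf_eq] at hS
    show (S.1 : LocalConfig (EuclideanSpace ℝ (Fin 3))).toMeasure = Measure.dirac 0
    rw [toMeasure_def, hS, Measure.restrict_singleton, Measure.count_singleton, one_smul]

/-- **THRESHOLD SHARPNESS.** For every `e > e*`, `MinimisingLawsHaveAtoms` with the minimising
hypothesis relaxed to `∫ rootEnergy dP ≤ e` (everything else verbatim) is FALSE. Any proof of the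
crux must use the exact value `e*`; no argument stable under perturbation of the energy level can
work. [folklore] -/
theorem not_minimisingLawsHaveAtoms_at_relaxed_threshold {e : ℝ} (he : eStar < e) :
    ¬ (∀ δ : ℝ, 0 < δ → ∀ P : Measure (Measure (EuclideanSpace ℝ (Fin 3))), IsProbabilityMeasure P →
      (∀ᵐ μ ∂P, IsRootedHardCore δ μ) → IsPointStationaryLaw P →
      (∫ μ, rootEnergy lennardJones μ ∂P) ≤ e →
      ∃ Y : Set (EuclideanSpace ℝ (Fin 3)), 0 < P {μ | ∃ A : EuclideanSpace ℝ (Fin 3) →ₗᵢ[ℝ]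
        EuclideanSpace ℝ (Fin 3), ∃ q ∈ Y, μ = (Measure.count : Measure
          (EuclideanSpace ℝ (Fin 3))).restrict ((fun s => A (s - q)) '' Y)}) := by
  intro H
  obtain ⟨δ, hδ, P, hP, hhc, hst, hE, hdiff⟩ := exists_diffuse_law_lt he
  obtain ⟨Y, hY⟩ := H δ hδ P hP hhc hst hE
  exact hY.ne' (hdiff Y)

/-- **NO COERCIVITY OF PURITY** (refutation of the quantitative strengthening S⁺4): there is no
`κ > 0` such that `E_P[h] − e* ≥ κ · (1 − P(rootedClass Y))` for all `Y` fails to be beaten — precisely: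
it is false that some `κ > 0` bounds `E_P[h] − e*` below by `κ (1 − P(rootedClass Y).toReal)` for
every law of the frame and every `Y`. Isometry-diffuse point-stationary hard-core laws have
energies accumulating at `e*`. [folklore] -/
theorem not_coercive_purity :
    ¬ ∃ κ : ℝ, 0 < κ ∧ ∀ δ : ℝ, 0 < δ → ∀ P : Measure (Measure (EuclideanSpace ℝ (Fin 3))),
      IsProbabilityMeasure P → (∀ᵐ μ ∂P, IsRootedHardCore δ μ) → IsPointStationaryLaw P →
      ∃ Y : Set (EuclideanSpace ℝ (Fin 3)),
        κ * (1 - (P {μ | ∃ A : EuclideanSpace ℝ (Fin 3) →ₗᵢ[ℝ] EuclideanSpace ℝ (Fin 3), ∃ q ∈ Y,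
          μ = (Measure.count : Measure (EuclideanSpace ℝ (Fin 3))).restrict
            ((fun s => A (s - q)) '' Y)}).toReal) ≤
          (∫ μ, rootEnergy lennardJones μ ∂P) - eStar := by
  rintro ⟨κ, hκ, H⟩
  obtain ⟨δ, hδ, P, hP, hhc, hst, hE, hdiff⟩ := exists_diffuse_law_lt (e := eStar + κ / 2) (by linarith)
  obtain ⟨Y, hY⟩ := H δ hδ P hP hhc hst
  rw [hdiff Y, ENNReal.toReal_zero, sub_zero, mul_one] at hY
  linarith

end Summit.AtomisticToContinuum.Crystallization.Theorems.MinimisingLawsHaveAtoms.Negative.ThresholdSharpness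

end
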